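import Literature.MathematicalPhysics.QuantumFieldTheory.Balaban1983to89.Node00.Record12
import Summits.QuantumFields.YangMills.Theorems.BalabanUVNodesN28AtRecord11

/-!
# BalabanUVNodes ∕ N28 — binder B6 «`0 < β̄`, `0 < γc`» AT NODE 00's REPAIRED STAGE-12 RECORD `IsRecordOfRecord₁₂C`, over the β OF
# RECORD read THROUGH THE STAGE-11 VIEW (`betaOfRecord₁₁ (θ.toStage11 F N p)`, def-B): the Stage-12 twin of `BalabanUVNodesN28AtRecord11`

HONEST FRAMING.  Count-neutral kernel bookkeeping BY NAME for a VACATED binder (N28 «closes with B3», N25 = NODE O); NOT a node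
discharge, not an estimate; nothing of Bałaban's β asserted or refuted; every `∀`-form over `IsRecordOfRecord₁₂C` is NOT-A-DISCHARGE
(inhabitation at Stage 12 is the route's item K0′ `Record12Inhabited`, not claimed).  One finite four-torus programme at fixed `ε`;
nothing continuum ∕ ℝ⁴ ∕ OS ∕ mass-gap ∕ Clay.

WHY A STAGE-12 TWIN.  Seat node00-def-T's located defect №2 (`Node00.not_provisos₁₁`, `Node00.not_isRecordOfRecord₁₁C`): the Stage-11
proviso field `alphaPos` quantified the radii positivity (2.28) over ALL runs and is unsatisfiable, so EVERY theorem of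
`BalabanUVNodesN28AtRecord11` taking `θ.Provisos₁₁` or `IsRecordOfRecord₁₁C` is vacuous (10 of 13; its θ-keyed §1 and
`betaOfRecord₁₁_eq_zeroHBeta_of_one` are immune).  The Stage-12 record `Node00/Record12.lean` carries the repair (`Provisos₁₂`: no all-runs radii
field, `bg` window-guarded), and its β face is UNCHANGED: `(datumOfRecord₁₂ θ h).βfun = betaOfRecord₁₀ θ.toStage9Params` (`rfl`), which IS
def-B's `betaOfRecord₁₁ (θ.toStage11 F N p) = betaOfMerged (betaMergedOfRecord₁₁ (θ.toStage11 F N p)) (beta0OfRecord₁₁ (θ.toStage11 F N p)) θ.γ`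
at EVERY run `p` (`rfl`: the view's Stage-9 part is `θ`'s — §0), so N28's two faces re-key to the Stage-12 record through the VIEW and
def-B's ∕ dag-n26-c's θ-keyed Stage-11 names, never through `Provisos₁₁` (Stage 12 has no `Provisos₁₂ → Provisos₁₁`).
* §0 the β objects of record at two views agree (`rfl`; documents that the run `p` keying the names is idle).
* §1 `0 < θ.γ` (load-bearing: `N28AtBetaOfRecord.betaOfMerged_of_nonpos` cannot fire), NEW at Stage 12 `θ.γ < 1` (the Stage-12 sign clause:
  the record box lies inside `]0,1[`, so N28's `γc := w.γ` is capped below `1` at every Stage-12 record), and B6's necessary-condition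
  shadow `θ.ρ8 ≠ 0` (`2 ≤ N`) at admissible Stage-12 parameters.
* §2 N28's `γc`-HALF: (B4) with `0 < γc` for the Stage-12 datum from joint continuity of the merged β of record (read at any view) on the
  binding world's OWN box, witness `γc := w.γ` (window ∕ converse ∕ record forms).  WATCH (dag-ref-D READ #106∕#107, N26-LIMIT-JUNK): the
  socket `hC : BetaContH w.γ (betaMergedOfRecord₁₁ …)` is junk-true wherever the (1.21) `polLimit` exists nowhere (the merged β is then
  constant in the history); a CLOSER of the `γc`-half must carry the limit's existence on the box — N26's ∕ NODE O's statement, displayed here,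
  never asserted.
* §3 N28's `β̄`-HALF: every one-loop split of the Stage-12 datum's β has `β0 = beta0OfRecord₁₁ (θ.toStage11 F N p)` (dag-n26-c's
  `β0_eq_beta0OfRecord₁₁` at the view); control rule v0.29's shape with `Beta0LimitExists` DISPLAYED; the literal (B3) is rigid; the packaged
  literal pair `BetaPertHyp` at the datum ↔ at the merged β; record form.
* §4 THE `N = 1` GUARD AT STAGE 12, transport-generically: at the zero chart the β of record over ANY transport family vanishes
  (`betaOfRecord₈T_of_zeroChart`, the `T`-generic twin of dag-n23-b's `Record8Inhabited.betaOfRecord₈_of_zeroChart`), hence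
  `betaOfRecord₁₀ F 1 θ = zeroHBeta` at every admissible Stage-9 parameter of `SU(1)` and the Stage-12 datum's β is the zero family:
  N28's `γc`-half HOLDS and `0 < β̄` FAILS at every Stage-12 record of `SU(1)` — the clause `2 ≤ N` is load-bearing for any β-side `∃`-claim.
Sources: T. Bałaban, CMP **109** (1987) 249–301 [Balaban1987RG1] (1.20)–(1.22) p. 264, (2.12)–(2.14) p. 268, Thm 2 (0.31) p. 259;
CMP **119** (1988) 243–285 [Balaban1988Convergent] (2.28) p. 259 (the window `]0, γ] ⊆ ]0, 1[`); CMP **122** (1989) 355–392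
[Balaban1989LargeFieldII] Thm 1 p. 355; B. C. Hall (2015) Example 7.3.  0 `def`, 0 `sorry`, standard axioms.
-/

namespace Summit.QuantumFields.YangMills.BalabanUVNodes.N28AtRecord12

open Literature.MathematicalPhysics.QuantumFieldTheory.Balaban1983to89
open Literature.MathematicalPhysics.QuantumFieldTheory.Balaban1983to89.FlowStep
open Literature.MathematicalPhysics.QuantumFieldTheory.Balaban1983to89.Node00
open Literature.MathematicalPhysics.QuantumFieldTheory.Balaban1983to89.T4Continuum (T4Family BetaPertHyp FiniteEpsData)
open Literature.MathematicalPhysics.QuantumFieldTheory.Balaban1983to89.T4FiniteEpsInhabited (zeroHBeta)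
open Literature.MathematicalPhysics.QuantumFieldTheory.Balaban1983to89.DagBinding (WorldP)
open Literature.MathematicalPhysics.QuantumFieldTheory.Balaban1983to89.BetaPertRigid (RemainderVanishes)
open Literature.MathematicalPhysics.QuantumFieldTheory.Balaban1983to89.Node00.Record8Inhabited (betaMerged_zeroChart beta0OfMerged_zeroHBeta
  betaOfMerged_zeroHBeta)
open Summit.QuantumFields.YangMills.BalabanUVNodes.N28AtBetaOfRecord
open Summit.QuantumFields.YangMills.BalabanUVNodes.N28ZeroChart
open Summit.QuantumFields.YangMills.BalabanUVNodes.N28AtRecord11 (betaOfRecord₁₁_eq_zeroHBeta_of_one)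
open Summit.QuantumFields.YangMills.Theorems.BalabanUVNodesN26AtBetaOfRecord11 (β0_eq_beta0OfRecord₁₁ oneLoopSplit_eq_oneLoopSplitOfRecord₁₁)
open scoped Matrix.Norms.L2Operator

variable {F : T4Family} {N : ℕ} [NeZero N]

/-! ## §0 The β objects of record at the Stage-11 views of a Stage-12 parameter do not depend on the run -/

/-- **THE RUN KEYING THE VIEW IS IDLE FOR THE β OF RECORD**: the merged β, the one-loop numbers and the β-functions of record read at
two Stage-11 views `θ.toStage11 F N p`, `θ.toStage11 F N p'` of the same Stage-12 parameter AGREE (`rfl`: all three read the view's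
Stage-9 part, which is `θ.toStage9Params`), and the β-functions ARE the Stage-12 datum's `βfun` (`Node00.βfun_datumOfRecord₁₂`).
[cite: Balaban1987RG1, (1.20)–(1.22) p.264 (bookkeeping)] -/
theorem betaObjectsOfRecord₁₁_view_eq (θ : Stage12Params F N) (h : θ.Provisos₁₂ F N) (p p' : B12.RunParams) :
    betaMergedOfRecord₁₁ F N (θ.toStage11 F N p) = betaMergedOfRecord₁₁ F N (θ.toStage11 F N p') ∧
      beta0OfRecord₁₁ F N (θ.toStage11 F N p) = beta0OfRecord₁₁ F N (θ.toStage11 F N p') ∧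
      betaOfRecord₁₁ F N (θ.toStage11 F N p) = (datumOfRecord₁₂ F N θ h).βfun :=
  ⟨rfl, rfl, rfl⟩

/-! ## §1 What Stage-12 admissibility gives N28, by name -/

/-- **THE LOAD-BEARING FACE `0 < θ.γ`** at admissible Stage-12 parameters (₉-admissibility's `gamma_pos`): the box of record is
non-empty, so the β of record is NOT the constant family of its one-loop numbers (`betaOfMerged_of_nonpos` cannot fire).
[cite: Balaban1987RG1, (1.22) p.264 («defined on the interval [0, γ]»)] -/
theorem gamma_pos_of_admissible₁₂ {θ : Stage12Params F N} (hθ : θ.Admissible F N) : 0 < θ.γ := hθ.toStage9.gamma_pos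

/-- **NEW AT STAGE 12: `θ.γ < 1`** — the Stage-12 sign clause `Pos₁₂` places the coupling window `]0, γ]` inside `]0, 1[` (where
`log g⁻² > 0` and the radii (2.28) are positive), so every box N28's `γc` can be read on is capped below `1`.
[cite: Balaban1988Convergent, (2.28) p.259] -/
theorem gamma_lt_one_of_admissible₁₂ {θ : Stage12Params F N} (hθ : θ.Admissible F N) : θ.γ < 1 := hθ.pos₁₂.2.2.2.2

/-- **B6's NECESSARY-CONDITION SHADOW AT STAGE 12**: at admissible Stage-12 parameters with `2 ≤ N` the β-layer's chart `θ.ρ8` is not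
the zero map (₉-admissibility's chart clause of record with `0 < θ.cβ`; `IsChartOfRecord.rho8_ne_zero`). [cite: Balaban1987RG1, (1.20)–(1.21) p.264] -/
theorem rho8_ne_zero_of_admissible₁₂ {θ : Stage12Params F N} (hθ : θ.Admissible F N) (hN : 2 ≤ N) :
    (letI := θ.instVβ₁; letI := θ.instVβ₂; θ.ρ8) ≠ 0 :=
  hθ.toStage9.chart.2.rho8_ne_zero hθ.toStage9.chart.1 hN

/-- **N28's window at a Stage-12 record lies inside `]0, 1[`**: `0 < w.γ < 1` (the record's γ-clause `0 < w.γ ≤ θ.γ` and §1's `θ.γ < 1`).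
[cite: Balaban1988Convergent, (2.28) p.259; Balaban1989LargeFieldII, Thm 1 p.355 (bookkeeping)] -/
theorem window_of_isRecordOfRecord₁₂C {D : FiniteEpsData F (SU N)} {w : WorldP} (h : IsRecordOfRecord₁₂C F N D w) : 0 < w.γ ∧ w.γ < 1 := by
  obtain ⟨θ, _, hθ, -, -, hw, -, -⟩ := h
  exact ⟨hw.1, lt_of_le_of_lt hw.2 (gamma_lt_one_of_admissible₁₂ hθ)⟩

/-! ## §2 N28's `γc`-half at a Stage-12 record -/

/-- **(B4) WITH N28's SIDE CONDITION AT A STAGE-12 DATUM, from the world's own box.**  For Stage-12 parameters `θ` (with provisos), any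
run `p` keying the Stage-11 view, and a world obeying the record's γ-clause `0 < w.γ ≤ θ.γ`: joint continuity of the MERGED β of record on
the binding world's box `]0, w.γ]^{k+1}` gives (B4) for the Stage-12 datum with `γc := w.γ` (def-B's `betaContH_betaOfRecord₁₁_iff` at the
view).  Hypothesis displayed, not asserted (WATCH N26-LIMIT-JUNK: junk-true where the (1.21) limit exists nowhere).
[cite: Balaban1989LargeFieldII, Thm 1 p.355; Balaban1987RG1, §1 p.264] -/
theorem b4_with_sideCondition_record₁₂_window (θ : Stage12Params F N) (h : θ.Provisos₁₂ F N) (p : B12.RunParams) (w : WorldP)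
    (hw : 0 < w.γ ∧ w.γ ≤ θ.γ) (hC : BetaContH w.γ (betaMergedOfRecord₁₁ F N (θ.toStage11 F N p))) :
    0 < w.γ ∧ BetaContH w.γ (datumOfRecord₁₂ F N θ h).βfun :=
  ⟨hw.1, (betaContH_betaOfRecord₁₁_iff (θ.toStage11 F N p) hw.2).mpr hC⟩

/-- … and conversely: (B4) for the Stage-12 datum on a window `w.γ ≤ θ.γ` GIVES the merged-β continuity on that window (at every view).
[cite: Balaban1987RG1, §1 p.264] -/
theorem betaContH_merged_view_of_b4_window₁₂ (θ : Stage12Params F N) (h : θ.Provisos₁₂ F N) (p : B12.RunParams) (w : WorldP)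
    (hle : w.γ ≤ θ.γ) (hC : BetaContH w.γ (datumOfRecord₁₂ F N θ h).βfun) : BetaContH w.γ (betaMergedOfRecord₁₁ F N (θ.toStage11 F N p)) :=
  (betaContH_betaOfRecord₁₁_iff (θ.toStage11 F N p) hle).mp hC

/-- **(B4) WITH `0 < γc < 1` AT A STAGE-12 RECORD, window form.**  Fix any run `p` to key the views.  If at every admissible presentation
`(θ, hP)` of `D` whose record box contains the world's window the merged β of record (read at the view `θ.toStage11 F N p`) is jointly
continuous on the WORLD's box `]0, w.γ]^{k+1}`, then `(D, w)` satisfies binder (B4) with N28's side condition — witness `γc := w.γ`,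
here also `< 1`. [cite: Balaban1989LargeFieldII, Thm 1 p.355; Balaban1988Convergent, (2.28) p.259] -/
theorem exists_b4_of_isRecordOfRecord₁₂C_window {D : FiniteEpsData F (SU N)} {w : WorldP} (h : IsRecordOfRecord₁₂C F N D w)
    (p : B12.RunParams)
    (hC : ∀ (θ : Stage12Params F N) (hP : θ.Provisos₁₂ F N), θ.Admissible F N → D = datumOfRecord₁₂ F N θ hP → w.γ ≤ θ.γ →
      BetaContH w.γ (betaMergedOfRecord₁₁ F N (θ.toStage11 F N p))) :
    ∃ γc : ℝ, (0 < γc ∧ γc < 1) ∧ BetaContH γc D.βfun := by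
  obtain ⟨θ, hP, hθ, hD, -, hw, -, -⟩ := h
  subst hD
  exact ⟨w.γ, ⟨hw.1, lt_of_le_of_lt hw.2 (gamma_lt_one_of_admissible₁₂ hθ)⟩,
    (b4_with_sideCondition_record₁₂_window θ hP p w hw (hC θ hP hθ rfl hw.2)).2⟩

/-! ## §3 N28's `β̄`-half at a Stage-12 record -/

/-- **THE ONE-LOOP NUMBERS A NODE-O ROAD READS AT A STAGE-12 DATUM ARE `beta0OfRecord₁₁ (θ.toStage11 F N p)` BY NAME** (any run `p`, §0):
for every one-loop split `S` of the Stage-12 datum's β-functions, `S.β0 = beta0OfRecord₁₁ (θ.toStage11 F N p)` (the split is never a choice —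
dag-n26-c's `β0_eq_beta0OfRecord₁₁` read at the view, whose β IS the datum's). [cite: Balaban1987RG1, (2.12)–(2.14) p.268] -/
theorem oneLoopSplit_β0_record₁₂ (θ : Stage12Params F N) (h : θ.Provisos₁₂ F N) (p : B12.RunParams)
    (S : B12Beta.OneLoopSplit (datumOfRecord₁₂ F N θ h).βfun) : S.β0 = beta0OfRecord₁₁ F N (θ.toStage11 F N p) :=
  β0_eq_beta0OfRecord₁₁ F N (θ.toStage11 F N p) S

/-- **N28's `β̄` BECOMES (AF-0) OF THE ONE-LOOP NUMBERS OF RECORD — control rule v0.29's shape at Stage 12.**  A uniform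
asymptotic-freedom bound `0 < b ≤ D.βfun` for the Stage-12 datum on a box `]0,γ']^{k+1}` inside the record box (`γ' ≤ θ.γ`) whose
interior contains the reference histories `θ.v₀`, together with the NAMED existence of the one-sided limits
`Beta0LimitExists (betaMergedOfRecord₁₁ (θ.toStage11 F N p)) θ.v₀`, gives `0 < b ≤ beta0OfRecord₁₁ (θ.toStage11 F N p) k` for EVERY `k`.
Hypotheses, not facts ([Balaban1989LargeFieldII] p. 355 «has not been published yet»); by §4 `hlo` is UNSATISFIABLE at `N = 1`.
[cite: Balaban1989LargeFieldII, Thm 1 p.355; Balaban1987RG1, Thm 2 (0.31) p.259] -/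
theorem beta0_record₁₂_pos_of_betaLowerH (θ : Stage12Params F N) (h : θ.Provisos₁₂ F N) (p : B12.RunParams)
    (hlim : Beta0LimitExists (betaMergedOfRecord₁₁ F N (θ.toStage11 F N p)) θ.v₀) {b γ' : ℝ} (hγ' : 0 < γ') (hγ : γ' ≤ θ.γ) (hb : 0 < b)
    (hv₀ : ∀ k (i : Fin (k + 1)), i ≠ Fin.last k → 0 < θ.v₀ k i ∧ θ.v₀ k i ≤ γ')
    (hlo : BetaLowerH b γ' (datumOfRecord₁₂ F N θ h).βfun) (k : ℕ) :
    0 < beta0OfRecord₁₁ F N (θ.toStage11 F N p) k ∧ b ≤ beta0OfRecord₁₁ F N (θ.toStage11 F N p) k :=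
  have hlo' := (betaLowerH_betaOfRecord₁₁_iff (θ.toStage11 F N p) hγ).mp hlo
  ⟨beta0OfMerged_pos_of_betaLowerH hlim hγ' hb hv₀ hlo' k, le_beta0OfMerged_of_betaLowerH hlim hγ' hv₀ hlo' k⟩

/-- **THE LITERAL (B3) AT A STAGE-12 DATUM IS RIGID.**  If the remainder of a (hence THE) one-loop split of the Stage-12 datum's β
vanishes along the diagonal as `g → 0⁺` and the LITERAL binder (B3) `BetaPertH D.βfun β̄` holds, then every one-loop number of record
equals `β̄` — which is why the literal (B3) is superseded by `DagBinding.EndpointExistence` and N28 is VACATED with it.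
[cite: Balaban1989LargeFieldII, Thm 1 p.355; Balaban1987RG1, (2.12)–(2.14) p.268] -/
theorem beta0_record₁₂_eq_betabar_of_literalB3 (θ : Stage12Params F N) (h : θ.Provisos₁₂ F N) (p : B12.RunParams)
    (S : B12Beta.OneLoopSplit (datumOfRecord₁₂ F N θ h).βfun) (hrem : RemainderVanishes S) {βbar : ℝ}
    (hB3 : BetaPertH (datumOfRecord₁₂ F N θ h).βfun βbar) (k : ℕ) : beta0OfRecord₁₁ F N (θ.toStage11 F N p) k = βbar := by
  have hS : S = oneLoopSplitOfRecord₁₁ F N (θ.toStage11 F N p) := oneLoopSplit_eq_oneLoopSplitOfRecord₁₁ F N (θ.toStage11 F N p) S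
  subst hS
  exact beta0_eq_betabar_of_literalB3 hrem hB3 k

/-- **N28's LITERAL PAIR AT A STAGE-12 DATUM.**  At admissible Stage-12 parameters the packaged literal β-binder of the UV headline,
`T4Continuum.BetaPertHyp` (= (B3) with `0 < β̄` ∧ (B4) with `0 < γc`), holds for the Stage-12 datum's β-functions iff it holds for the
merged β of record (read at any view; `betaPertHyp_betaOfMerged_iff` at `0 < θ.γ`). [cite: Balaban1989LargeFieldII, Thm 1 p.355] -/
theorem betaPertHyp_record₁₂_iff (θ : Stage12Params F N) (h : θ.Provisos₁₂ F N) (p : B12.RunParams) (hθ : θ.Admissible F N) :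
    BetaPertHyp (datumOfRecord₁₂ F N θ h).βfun ↔ BetaPertHyp (betaMergedOfRecord₁₁ F N (θ.toStage11 F N p)) :=
  betaPertHyp_betaOfMerged_iff (gamma_pos_of_admissible₁₂ hθ)

/-- **N28 AT A STAGE-12 RECORD, packaged.**  Fix any run `p` to key the views.  At a Stage-12 record `(D, w)`: the window satisfies
`0 < w.γ < 1`; and IF the merged β of record of every admissible presentation (with its provisos) satisfies the literal pair, so does
`D.βfun` — N28's `0 < β̄`, `0 < γc` carried inside `BetaPertHyp`.  All hypotheses displayed; nothing of Bałaban's β asserted.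
[cite: Balaban1989LargeFieldII, Thm 1 p.355; Balaban1988Convergent, (2.28) p.259] -/
theorem betaPertHyp_of_isRecordOfRecord₁₂C {D : FiniteEpsData F (SU N)} {w : WorldP} (h : IsRecordOfRecord₁₂C F N D w) (p : B12.RunParams)
    (hB : ∀ (θ : Stage12Params F N) (hP : θ.Provisos₁₂ F N), θ.Admissible F N → D = datumOfRecord₁₂ F N θ hP →
      BetaPertHyp (betaMergedOfRecord₁₁ F N (θ.toStage11 F N p))) :
    (0 < w.γ ∧ w.γ < 1) ∧ BetaPertHyp D.βfun := by
  refine ⟨window_of_isRecordOfRecord₁₂C h, ?_⟩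
  obtain ⟨θ, hP, hθ, hD, -⟩ := h
  rw [hD]
  exact (betaPertHyp_record₁₂_iff θ hP p hθ).mpr (hB θ hP hθ hD)

/-! ## §4 The `N = 1` guard at Stage 12: at every admissible parameter of `SU(1)` the β of record vanishes genuinely -/

/-- **THE β OF RECORD OVER ANY TRANSPORT FAMILY VANISHES AT THE ZERO CHART** — the transport-generic twin of dag-n23-b's
`Record8Inhabited.betaOfRecord₈_of_zeroChart`: with `ρ8 = 0` the merged β of every term family is the zero family (`betaMerged_zeroChart`),
so are its one-loop numbers and the split-compatible β. [cite: Balaban1987RG1, (1.20)–(1.22) p.264 (bookkeeping at `ρ = 0`)] -/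
theorem betaOfRecord₈T_of_zeroChart (T : Transport F N) (θ : Stage8Params F N) (h : letI := θ.instVβ₁; letI := θ.instVβ₂; θ.ρ8 = 0) :
    betaOfRecord₈T F N T θ = zeroHBeta := by
  letI := θ.instVβ₁; letI := θ.instVβ₂; letI := θ.instιβ
  unfold betaOfRecord₈T
  rw [h, betaMerged_zeroChart, beta0OfMerged_zeroHBeta, betaOfMerged_zeroHBeta]

section One

variable {F : T4Family}

/-- **At `N = 1` the Stage-10 β of record (`betaOfRecord₁₀ = betaOfRecord₉c`, the continuous-version transport `TcOfRecord`) is the zero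
family at every admissible Stage-9 parameter**: ₉-admissibility carries a chart of record, at `N = 1` that chart is the zero map (𝔰𝔲(1) = 0,
`IsChartOfRecord.rho8_eq_zero_of_one`). [cite: Hall2015, Example 7.3; Balaban1987RG1, (1.20)–(1.22) p.264 (bookkeeping at N = 1)] -/
theorem betaOfRecord₁₀_eq_zeroHBeta_of_one (θ : Stage9Params F 1) (hθ : θ.Admissible) : betaOfRecord₁₀ F 1 θ = zeroHBeta :=
  betaOfRecord₈T_of_zeroChart (TcOfRecord F 1) θ.toStage8Params hθ.chart.2.rho8_eq_zero_of_one

/-- **At `N = 1` the Stage-12 datum's β-functions are the zero family** (FACE β `rfl` + `betaOfRecord₁₀_eq_zeroHBeta_of_one`; equivalently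
g0's `betaOfRecord₁₁_eq_zeroHBeta_of_one` at any view). [cite: Hall2015, Example 7.3; Balaban1987RG1, (1.20)–(1.22) p.264 (bookkeeping at N = 1)] -/
theorem βfun_datumOfRecord₁₂_eq_zeroHBeta_of_one (θ : Stage12Params F 1) (h : θ.Provisos₁₂ F 1) (hθ : θ.Admissible F 1) :
    (datumOfRecord₁₂ F 1 θ h).βfun = zeroHBeta :=
  betaOfRecord₁₀_eq_zeroHBeta_of_one θ.toStage9Params hθ.toStage9

/-- The same fact read at a view: at `N = 1` the β of record of every Stage-11 view of an admissible Stage-12 parameter is the zero family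
(g0's `betaOfRecord₁₁_eq_zeroHBeta_of_one` at `Admissible.toStage11`). [cite: Hall2015, Example 7.3 (bookkeeping at N = 1)] -/
theorem betaOfRecord₁₁_view_eq_zeroHBeta_of_one (θ : Stage12Params F 1) (hθ : θ.Admissible F 1) (p : B12.RunParams) :
    betaOfRecord₁₁ F 1 (θ.toStage11 F 1 p) = zeroHBeta :=
  betaOfRecord₁₁_eq_zeroHBeta_of_one _ (hθ.toStage11 p)

/-- **At `N = 1` a Stage-12 record's β-functions are the zero family.** [cite: Hall2015, Example 7.3; Balaban1987RG1, (1.20)–(1.22) p.264 (bookkeeping at N = 1)] -/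
theorem βfun_eq_zeroHBeta_of_isRecordOfRecord₁₂C_one {D : FiniteEpsData F (SU 1)} {w : WorldP} (h : IsRecordOfRecord₁₂C F 1 D w) :
    D.βfun = zeroHBeta := by
  obtain ⟨θ, hP, hθ, rfl, -⟩ := h
  exact βfun_datumOfRecord₁₂_eq_zeroHBeta_of_one θ hP hθ

/-- **N28's B6 CENSUS AT EVERY STAGE-12 RECORD OF `SU(1)`**: the `γc`-half with (B4) HOLDS (on the record's own window `w.γ ∈ ]0,1[`,
displayed as the witness), every one-loop number of every split is `0`, and the packaged literal pair `BetaPertHyp D.βfun` — N28's `0 < β̄` —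
FAILS.  Genuine, not junk: the clause `2 ≤ N` is load-bearing for any β-side `∃`-claim over `IsRecordOfRecord₁₂C`.
[cite: Balaban1989LargeFieldII, Thm 1 p.355; Balaban1987RG1, Thm 2 (0.31) p.259 and (2.12)–(2.14) p.268] -/
theorem b6Census_of_isRecordOfRecord₁₂C_one {D : FiniteEpsData F (SU 1)} {w : WorldP} (h : IsRecordOfRecord₁₂C F 1 D w) :
    (∃ γc : ℝ, (0 < γc ∧ γc < 1) ∧ BetaContH γc D.βfun) ∧ (∀ S : B12Beta.OneLoopSplit D.βfun, ∀ k, S.β0 k = 0) ∧ ¬ BetaPertHyp D.βfun := by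
  have hw := window_of_isRecordOfRecord₁₂C h
  rw [βfun_eq_zeroHBeta_of_isRecordOfRecord₁₂C_one h]
  exact ⟨⟨w.γ, hw, betaContH_zeroHBeta w.γ⟩, oneLoopSplit_β0_zeroHBeta, not_betaPertHyp_zeroHBeta⟩

end One

end Summit.QuantumFields.YangMills.BalabanUVNodes.N28AtRecord12
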